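import Literature.Analysis.FluidPDE.LerayHopfAssociatedPressure
import HarnessLib

/-!
# `u ∈ L^{10/3}((0, T) × ℝ³)` for Leray–Hopf weak solutions

Analysis/FluidPDE **proofs file** (theorems only: no definitions, no named facts, no `sorry`),
on the discharge path of `Literature.Analysis.FluidPDE.LeiZhang2011_regularity_bmoStream`
(the local maximum estimate for `Γ = r u^θ` of Lei–Zhang 2011, §2 (2.6), is started at the
energy exponent `10/3`). Companion of `IsLerayHopfOn.memLp_three_uncurry_slab`
(`LerayHopfAssociatedPressure`): the interpolation `L^∞_t L²_x ∩ L²_t L⁶_x ⊂ L^{10/3}_{t,x}`,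
`‖u‖_{10/3}^{10/3} ≤ ‖u‖₂^{4/3} ‖u‖₆² ≤ K^{2/3} C_S² ‖∇u‖₂²` (Robinson–Rodrigo–Sadowski 2016,
Lemma 3.5 / (3.20) with `r = s = 10/3`).

## References

* J. C. Robinson, J. L. Rodrigo, W. Sadowski, *The Three-Dimensional Navier–Stokes Equations*,
  CUP 2016, Lemma 3.5 and Thm. 3.7 ((3.20), `2/r + 3/s = 3/2`). [RobinsonRodrigoSadowski2016]
-/

noncomputable section

open MeasureTheory TopologicalSpace Set Function Filter Topology Metric InnerProductSpace
open scoped ENNReal NNReal RealInnerProductSpace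

namespace Literature.Analysis.FluidPDE

section SliceBound

variable {E : Type*} [NormedAddCommGroup E] [InnerProductSpace ℝ E] [FiniteDimensional ℝ E]
  [MeasurableSpace E] [BorelSpace E]
variable {T ν : ℝ} {u₀ : E → E} {u : ℝ → E → E}

/-- `∫ |f|^{10/3} = ‖f‖_{L^{10/3}}^{10/3}`. [folklore] -/
theorem lintegral_enorm_rpow_tenThirds_eq_eLpNorm_rpow {α : Type*} [MeasurableSpace α]
    {G : Type*} [NormedAddCommGroup G] (μ : Measure α) (f : α → G) :
    ∫⁻ x, ‖f x‖ₑ ^ (10 / 3 : ℝ) ∂μ =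
      eLpNorm f (ENNReal.ofReal (10 / 3)) μ ^ (10 / 3 : ℝ) := by
  have h0 : ENNReal.ofReal (10 / 3) ≠ 0 := by
    rw [ENNReal.ofReal_ne_zero_iff]; norm_num
  have e : (ENNReal.ofReal (10 / 3)).toReal = 10 / 3 := ENNReal.toReal_ofReal (by norm_num)
  rw [eLpNorm_eq_lintegral_rpow_enorm_toReal h0 ENNReal.ofReal_ne_top, e, ← ENNReal.rpow_mul]
  norm_num

/-- **`∫₀ᵀ ‖u(t)‖_{10/3}^{10/3} dt < ∞` for a Leray–Hopf solution in dimension `3`** with a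
jointly measurable weak-gradient witness of finite dissipation:
`‖u‖_{10/3}^{10/3} ≤ ‖u‖₂^{4/3} (C_S ‖∇u‖₂)² ≤ K^{2/3} C_S² ‖∇u‖₂²`
(`eLpNorm_le_of_hasWeakGradient` at `p = 10/3`), integrable in time.
[cite: RobinsonRodrigoSadowski2016, Lemma 3.5 and (3.20) (r = s = 10/3)] -/
theorem IsLerayHopfOn.lintegral_eLpNorm_tenThirds_rpow_lt_top (hE3 : Module.finrank ℝ E = 3)
    {f : ℝ → E → E} (hu : IsLerayHopfOn T ν f u₀ u) {G : ℝ → E → E →L[ℝ] E}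
    (hGm : StronglyMeasurable (uncurry G))
    (hG : ∀ᵐ t ∂(volume.restrict (Ioo 0 T)), HasWeakGradient (u t) (G t))
    (hG2 : ∫⁻ t in Ioo 0 T, ∫⁻ x, ENNReal.ofReal (frobeniusNormSq (G t x)) < ⊤) :
    ∫⁻ s in Ioo 0 T, eLpNorm (u s) (ENNReal.ofReal (10 / 3)) volume ^ (10 / 3 : ℝ) < ⊤ := by
  obtain ⟨K, hK⟩ := hu.energy_bound
  set Cs : ℝ≥0∞ := (SNormLESNormFDerivOfEqConst E (volume : Measure E) 2 : ℝ≥0∞) with hCs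
  set D : ℝ → ℝ≥0∞ := fun s => ∫⁻ x, ENNReal.ofReal (frobeniusNormSq (G s x)) with hD
  have hDm : Measurable D := measurable_lintegral_frobeniusNormSq hGm
  have hp2 : (2 : ℝ≥0∞) ≤ ENNReal.ofReal (10 / 3) := by
    rw [show (2 : ℝ≥0∞) = ENNReal.ofReal 2 by simp]
    exact ENNReal.ofReal_le_ofReal (by norm_num)
  have hp6 : ENNReal.ofReal (10 / 3) ≤ 6 := by
    rw [show (6 : ℝ≥0∞) = ENNReal.ofReal 6 by simp]
    exact ENNReal.ofReal_le_ofReal (by norm_num)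
  have e : (ENNReal.ofReal (10 / 3)).toReal = 10 / 3 := ENNReal.toReal_ofReal (by norm_num)
  -- pointwise bound for a.e. `s`
  have hpt : ∀ᵐ s ∂(volume.restrict (Ioo 0 T)),
      eLpNorm (u s) (ENNReal.ofReal (10 / 3)) volume ^ (10 / 3 : ℝ) ≤
        (K : ℝ≥0∞) ^ (2 / 3 : ℝ) * Cs ^ (2 : ℝ) * D s := by
    filter_upwards [hK, hG, ae_restrict_mem measurableSet_Ioo] with s hKs hGs hsI
    have hmem : MemLp (u s) 2 volume := hu.memLp s (Ioo_subset_Icc_self hsI)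
    have h1 := eLpNorm_le_of_hasWeakGradient hE3 hmem hGs hp2 hp6
    rw [e] at h1
    norm_num at h1
    -- `‖u‖₂ ≤ K^{1/2}`
    have h2 : eLpNorm (u s) 2 volume ≤ (K : ℝ≥0∞) ^ (1 / 2 : ℝ) := by
      rw [eEnergy_eq_eLpNorm_sq] at hKs
      calc eLpNorm (u s) 2 volume = (eLpNorm (u s) 2 volume ^ 2) ^ (1 / 2 : ℝ) := by
            rw [← ENNReal.rpow_natCast, ← ENNReal.rpow_mul]; norm_num
        _ ≤ (K : ℝ≥0∞) ^ (1 / 2 : ℝ) := ENNReal.rpow_le_rpow hKs (by norm_num)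
    have e1 : ∀ x : ℝ≥0∞, (x ^ (2 / 5 : ℝ)) ^ (10 / 3 : ℝ) = x ^ (4 / 3 : ℝ) := fun x => by
      rw [← ENNReal.rpow_mul]; norm_num
    have e2 : ∀ x : ℝ≥0∞, ((x ^ (1 / 2 : ℝ)) ^ (3 / 5 : ℝ)) ^ (10 / 3 : ℝ) = x := fun x => by
      rw [← ENNReal.rpow_mul, ← ENNReal.rpow_mul]; norm_num
    have e3 : ∀ x : ℝ≥0∞, (x ^ (3 / 5 : ℝ)) ^ (10 / 3 : ℝ) = x ^ (2 : ℝ) := fun x => by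
      rw [← ENNReal.rpow_mul]; norm_num
    calc eLpNorm (u s) (ENNReal.ofReal (10 / 3)) volume ^ (10 / 3 : ℝ)
        ≤ (eLpNorm (u s) 2 volume ^ (2 / 5 : ℝ) * (Cs * D s ^ (1 / 2 : ℝ)) ^ (3 / 5 : ℝ)) ^
            (10 / 3 : ℝ) := ENNReal.rpow_le_rpow h1 (by norm_num)
      _ = eLpNorm (u s) 2 volume ^ (4 / 3 : ℝ) * Cs ^ (2 : ℝ) * D s := by
          rw [ENNReal.mul_rpow_of_nonneg _ _ (by norm_num : (0 : ℝ) ≤ 10 / 3),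
            ENNReal.mul_rpow_of_nonneg _ _ (by norm_num : (0 : ℝ) ≤ 3 / 5),
            ENNReal.mul_rpow_of_nonneg _ _ (by norm_num : (0 : ℝ) ≤ 10 / 3), e1, e2, e3]
          ring
      _ ≤ ((K : ℝ≥0∞) ^ (1 / 2 : ℝ)) ^ (4 / 3 : ℝ) * Cs ^ (2 : ℝ) * D s := by
          gcongr
      _ = (K : ℝ≥0∞) ^ (2 / 3 : ℝ) * Cs ^ (2 : ℝ) * D s := by
          rw [← ENNReal.rpow_mul, show (1 : ℝ) / 2 * (4 / 3) = 2 / 3 by norm_num]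
  calc ∫⁻ s in Ioo 0 T, eLpNorm (u s) (ENNReal.ofReal (10 / 3)) volume ^ (10 / 3 : ℝ)
      ≤ ∫⁻ s in Ioo 0 T, (K : ℝ≥0∞) ^ (2 / 3 : ℝ) * Cs ^ (2 : ℝ) * D s := lintegral_mono_ae hpt
    _ = (K : ℝ≥0∞) ^ (2 / 3 : ℝ) * Cs ^ (2 : ℝ) * ∫⁻ s in Ioo 0 T, D s := by
        rw [lintegral_const_mul _ hDm]
    _ < ⊤ := by
        refine ENNReal.mul_lt_top (ENNReal.mul_lt_top ?_ ?_) hG2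
        · exact ENNReal.rpow_lt_top_of_nonneg (by norm_num) ENNReal.coe_ne_top
        · exact ENNReal.rpow_lt_top_of_nonneg (by norm_num) ENNReal.coe_ne_top

end SliceBound

section Slab

variable {T ν : ℝ} {f : ℝ → EuclideanSpace ℝ (Fin 3) → EuclideanSpace ℝ (Fin 3)}
  {u₀ : EuclideanSpace ℝ (Fin 3) → EuclideanSpace ℝ (Fin 3)}
  {u : ℝ → EuclideanSpace ℝ (Fin 3) → EuclideanSpace ℝ (Fin 3)}

/-- **Every Leray–Hopf weak solution on `ℝ³ × [0, T)` lies in `L^{10/3}((0, T) × ℝ³)`**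
(Robinson–Rodrigo–Sadowski 2016, (3.20) with `r = s = 10/3`; Tonelli over a jointly measurable
version, with the jointly measurable weak-gradient witness
`IsLerayHopfOn.exists_measurable_weakGradient`).
[cite: RobinsonRodrigoSadowski2016, Lemma 3.5 and (3.20)] -/
theorem IsLerayHopfOn.memLp_tenThirds_uncurry_slab (hu : IsLerayHopfOn T ν f u₀ u) :
    MemLp (uncurry u) (ENNReal.ofReal (10 / 3))
      (volume.restrict (Ioo 0 T ×ˢ (univ : Set (EuclideanSpace ℝ (Fin 3))))) := by
  have hm : AEStronglyMeasurable (uncurry u)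
      (volume.restrict (Ioo 0 T ×ˢ (univ : Set (EuclideanSpace ℝ (Fin 3))))) := hu.weak.1
  obtain ⟨G, hGm, hG, hG2, -⟩ := hu.exists_measurable_weakGradient
  have h3 := hu.lintegral_eLpNorm_tenThirds_rpow_lt_top finrank_euclideanSpace_fin hGm hG hG2
  refine ⟨hm, ?_⟩
  have hm' : AEStronglyMeasurable (uncurry u)
      ((volume.restrict (Ioo 0 T)).prod (volume : Measure (EuclideanSpace ℝ (Fin 3)))) := by
    rw [← volume_restrict_slab_eq_prod₃]; exact hm
  have h : ∫⁻ z in Ioo 0 T ×ˢ (univ : Set (EuclideanSpace ℝ (Fin 3))),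
      ‖uncurry u z‖ₑ ^ (10 / 3 : ℝ) < ⊤ := by
    rw [volume_restrict_slab_eq_prod₃, lintegral_prod _ (hm'.enorm.pow_const _)]
    calc ∫⁻ t in Ioo 0 T, ∫⁻ x, ‖uncurry u (t, x)‖ₑ ^ (10 / 3 : ℝ)
        = ∫⁻ t in Ioo 0 T, eLpNorm (u t) (ENNReal.ofReal (10 / 3)) volume ^ (10 / 3 : ℝ) :=
          lintegral_congr fun t => lintegral_enorm_rpow_tenThirds_eq_eLpNorm_rpow _ (u t)
      _ < ⊤ := h3
  rw [lintegral_enorm_rpow_tenThirds_eq_eLpNorm_rpow] at h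
  exact (ENNReal.rpow_lt_top_iff_of_pos (by norm_num)).1 h

end Slab

end Literature.Analysis.FluidPDE
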